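import Summits.BirchSwinnertonDyer.BirchSwinnertonDyer.Theorems.RamifiedHeegnerPairLeafPartnerGenusTransportDefs
import Summits.BirchSwinnertonDyer.BirchSwinnertonDyer.Theorems.RamifiedHeegnerPairLeafPartnerClassLedger
import Literature.NumberTheory.EllipticCurves.ShimuraCurveHeegnerSystemGenusThree
import Literature.NumberTheory.EllipticCurves.KolyvaginShaStructureIndexFormProofs
import Literature.NumberTheory.EllipticCurves.RingClassFieldGenusProofs
import Literature.NumberTheory.EllipticCurves.QuadraticTwistJInvariantProofs
import Literature.NumberTheory.EllipticCurves.LFunctionSmulProofs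
import Literature.NumberTheory.EllipticCurves.HeightsProofs
import Literature.NumberTheory.EllipticCurves.PeriodRationalityProofs
import HarnessLib

/-!
# Crux U₁ `LeafRankOneUpperAtThree` (stmt-BirchSwinnertonDyer-26022) ∕ U₀ (26024), line `partnerdescent` — partner kernel part 14:
# the BOTTOM of the genus descent — the `χ`-component `P_χ` of the conductor-`3` CM point, its descent to `W(K)` through the genus
# transport `ψ_θ`, the height bookkeeping, and the REAL DISPLAY of (DISPLAY-L) from the typed print input
# `Literature.NumberTheory.EllipticCurves.shimuraCurve_heegnerSystem_genusThree` (B1χ)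

HONEST FRAMING (lead prover `bsd-line-rhp-p2` g58, explicit-unit seat, cell `bsd-wall`): a SUPPORT file (`--supports 26022 --as helper`)
for the registered stub (DISPLAY-L) `stub_partnerGenusDisplayLabelledAtThree` (line `partnerdescent` v5 on U₁, `splitkolyvagin0` v18 on U₀).
It proves NO stub and closes NO item; BSD is proved for no curve. Theorems only; no definition, no named fact, no `sorry`.

WHAT. The port plan `Cruxes/LeafRankOneUpperAtThree/LEAD-G57-DISPLAYL-PORT.md` §4 reduces (DISPLAY-L) to ONE printed `V`-side input —
now TYPED, `shimuraCurve_heegnerSystem_genusThree` (p789293, this seat) — plus kernel assembly over parts 8–10. This file is the assembly's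
BOTTOM LEVEL (conductor `3` ↦ the displayed point `P ∈ W(K)`):
* §1 `pointGalHom_chiSum` — the `χ`-sum `P_χ = Σ_{g ∈ Gal(L/K)} χ(g)·g y` is `χ`-ISOTYPIC: `h·P_χ = χ(h)·P_χ` (`χ = genusSign θ`, a
  character: `genusSign_mul`; reindex the sum by `g ↦ hg`). Pure algebra over any field `L ∋ θ`, `θ² = −3`.
* §2 `exists_point_map_eq_genusTransport_chiSum` — hence `ψ_θ(P_χ) ∈ W(L)` is FIXED by `Gal(L/K)` (part 10's sign rule: `g` fixing `θ`
  acts on `ψ_θ P_χ` as on `P_χ`, `g` negating `θ` with the opposite sign — both give `+`), so for `L/K` Galois it DESCENDS: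
  `∃ P ∈ W(K)`, `P↑L = ψ_θ(P_χ)` (part 10 `exists_point_map_eq_genusTransport`).
* §3 `LDerivEK_eq_of_smul_eq`, `LDerivEK_quadraticTwist_negThree_partner` — `L′(V^{(−3)}/K) = L′(W/K)`: `V^{(−3)} ≅ W` over `ℚ`
  (`quadraticTwist_smul`, `quadraticTwist_quadraticTwist`, `W^{(9)} ≅ W^{(1)} ≅ W`) and `LDerivEK` is an isomorphism invariant
  (`entireLFunction_smul`).
* §4 `realDisplay_of_genusThree_bottom` — from the (B1χ) clause AT the data `(ι, y, degy)` of the fact, `θ ∈ K[3]` with `θ² = −3`,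
  the class ledger of part 9 (`c²·(2covol(Λ_W)deg(D₀)/c(D₀)²) = n·(8π²(f₀,f₀)/3)`, `3 ∤ c, n`, from `V ~ V₀` and `V[3]` irreducible) and
  `w_K = 2`: THERE ARE `P ∈ W(K)` and `degS ≥ 1` with `ord₃ degS = ord₃ deg P₀` and the stub's REAL display
  `degS·L′(W/K,1) = (2covol(Λ_W)·deg(D₀)/(c(D₀)²(w_K/2)²√|d_K|))·ĥ_K(P)` — with `P = c • (descent of ψ_θ P_χ)`, `degS = n·degy`, and the
  bookkeeping identity `P↑K[3] = c • ψ_θ(P_χ)` RETURNED (the labels (B2)–(B5) of the later parts are proved for THIS `P`).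
So after this file, (DISPLAY-L) ⟸ {the fact (B1χ)+(B3χ)+(B4′)+(B5′)} ∧ {Faltings `V ~ V₀` for the stub's free `V₀`} ∧ parts 8–10 ∧
{labels (B2)–(B5) for the re-signed descended family — parts 15+, templates: bsd-addord's `GenusKolyvagin.label_B4_level/label_B5_level`}.
[cite: CaiShuTian2014, Thm. 1.5 and special case 1] [cite: SilvermanAEC2009, X.5 Cor. 5.4 (iii), VIII.9.1, VIII.9.3 (b)]
[cite: ZagierCMB1985, §1 (p. 374)] [cite: GrossLMS1991, §4 (4.1)]
presearch: «genus character component of Heegner point descends to the twist; height over K of χ-component» → [corpus:arxiv-1312.3884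
Lemma 2.7/Thm 2.5] (CLTZ genus points `y_R ∈ E(K(√R))^{χ_R}`), [corpus:arxiv-1408.1733 p. 2, 7] (ĥ_K on `E(K^{ab})`); tree: part 10, part 9,
`GenusKolyvagin.*` (bsd-addord, X₀(N), `d₁ ∣ d_K`) — no conductor-3 descent in the tree; nothing restated (corpus+galaxy).
-/

set_option linter.dupNamespace false
set_option autoImplicit false

noncomputable section

open scoped Classical

namespace Summit.BirchSwinnertonDyer.BirchSwinnertonDyer.Theorems.LeafPartnerGenusBottom

open WeierstrassCurve Literature.NumberTheory.EllipticCurves LeafPartnerGenusTransport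

/-! ## §1 The `χ`-sum is `χ`-isotypic -/

section ChiSum

variable {L : Type} [Field L] [CharZero L] [Algebra ℚ L] (V : WeierstrassCurve ℚ)

/-- **The `χ`-sum is `χ`-isotypic.** For a subgroup `G` of `Aut(L/ℚ)` enumerated by a finset `T`, `θ ∈ L` with `θ² = −3`, a point
`y ∈ V(L)` and `P_χ := Σ_{g ∈ T} χ(g)·g y` (`χ = genusSign θ`): every `h ∈ G` acts by `h·P_χ = χ(h)·P_χ` (`χ` is a character with
values `±1`; reindex by `g ↦ hg`). This is how Cai–Shu–Tian's `P⁰_χ(f)` sits in the `χ`-eigenspace. [cite: CaiShuTian2014, §1.1 (P_χ)]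
[cite: SilvermanAEC2009, X.2 Prop. 2.4 (proof: the sign cocycle)] -/
theorem pointGalHom_chiSum [DecidableEq L] (G : Subgroup (L ≃ₐ[ℚ] L)) (T : Finset (L ≃ₐ[ℚ] L)) (hT : ∀ g, g ∈ T ↔ g ∈ G)
    {θ : L} (hθ2 : θ ^ 2 = algebraMap ℚ L (-3)) {h : L ≃ₐ[ℚ] L} (hh : h ∈ G) (y : (V.baseChange L).toAffine.Point) :
    pointGalHom V L h (∑ g ∈ T, ((genusSign θ g : ℤˣ) : ℤ) • pointGalHom V L g y) =
      ((genusSign θ h : ℤˣ) : ℤ) • ∑ g ∈ T, ((genusSign θ g : ℤˣ) : ℤ) • pointGalHom V L g y := by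
  have hθ : θ ≠ -θ := ne_neg_of_ne_zero (theta_ne_zero hθ2)
  have hcomp : ∀ g : L ≃ₐ[ℚ] L, pointGalHom V L h (pointGalHom V L g y) = pointGalHom V L (h * g) y := fun g => by
    rw [map_mul]; rfl
  rw [map_sum, Finset.smul_sum]
  simp_rw [map_zsmul, hcomp]
  -- reindex `g ↦ h * g`
  refine Finset.sum_bij' (fun g _ => h * g) (fun g _ => h⁻¹ * g) (fun g hg => ?_) (fun g hg => ?_)
    (fun g _ => by simp) (fun g _ => by simp) (fun g hg => ?_)
  · exact (hT _).mpr (G.mul_mem hh ((hT g).mp hg))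
  · exact (hT _).mpr (G.mul_mem (G.inv_mem hh) ((hT g).mp hg))
  · rw [smul_smul, ← Units.val_mul, genusSign_mul hθ2 hθ h g, ← mul_assoc, Int.units_mul_self, one_mul]

end ChiSum

/-! ## §2 Descent of `ψ_θ(P_χ)` to `W(K)` -/

section Descent

variable (W : WeierstrassCurve ℚ) {W₁ : WeierstrassCurve ℚ} [W₁.IsCharNeTwoNF] (C₁ : VariableChange ℚ) (hC₁ : C₁ • W = W₁)
  {V : WeierstrassCurve ℚ} (CV : VariableChange ℚ) (hV : CV • W₁.quadraticTwist (-3) = V)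
  {K : Type} [Field K] [CharZero K] {E : Type} [Field E] [CharZero E] [Algebra K E]

/-- A `K`-automorphism of `E`, read over `ℚ`, lies in the subgroup of `Aut(E/ℚ)` fixing the image of `K` — the shape of the tree's
`ringClassGal` (`fixingSubgroup` of `Set.range (algebraMap K E)` read in `E`). [folklore] -/
theorem restrictScalars_mem_fixingSubgroup (τ : E ≃ₐ[K] E) (S : Set E) (hS : S ⊆ Set.range (algebraMap K E)) :
    (τ.restrictScalars ℚ : E ≃ₐ[ℚ] E) ∈ fixingSubgroup (E ≃ₐ[ℚ] E) S := by
  rw [mem_fixingSubgroup_iff]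
  rintro x hx
  obtain ⟨k, rfl⟩ := hS hx
  exact τ.commutes k

/-- `pointGalHom` of the `ℚ`-restriction of a `K`-automorphism is `Point.map` of the `K`-automorphism. [folklore] -/
theorem pointGalHom_restrictScalars [DecidableEq E] (X : WeierstrassCurve ℚ) (τ : E ≃ₐ[K] E) (P : (X.baseChange E).toAffine.Point) :
    pointGalHom X E (τ.restrictScalars ℚ) P = Affine.Point.map (τ : E →ₐ[K] E) P := by
  rw [pointGalHom_apply]
  rcases P with _ | ⟨x, y, h⟩ <;> rfl

/-- **Descent of the transported `χ`-component.** Let `E/K` be Galois (on the line `E = K[3]`), `G ≤ Aut(E/ℚ)` a subgroup containing the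
`ℚ`-restrictions of all `K`-automorphisms (on the line `G = Gal(K[3]/K) = ringClassGal ι 3`), `T` an enumeration of `G`, `θ ∈ E` with
`θ² = −3`, `y ∈ V(E)`, `P_χ := Σ_{g ∈ T} χ(g)·g y`. Then `ψ_θ(P_χ)` is fixed by `Gal(E/K)` (§1 + part 10's sign rule) and there is
`P ∈ W(K)` with `P↑E = ψ_θ(P_χ)`. [cite: SilvermanAEC2009, X.5 Cor. 5.4 (iii), VIII.§1] [cite: CaiShuTian2014, §1.1 (P_χ)] -/
theorem exists_point_map_eq_genusTransport_chiSum [IsGalois K E] [DecidableEq E]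
    (G : Subgroup (E ≃ₐ[ℚ] E)) (hG : ∀ τ : E ≃ₐ[K] E, (τ.restrictScalars ℚ : E ≃ₐ[ℚ] E) ∈ G)
    (T : Finset (E ≃ₐ[ℚ] E)) (hT : ∀ g, g ∈ T ↔ g ∈ G)
    {θ : E} (hθ2 : θ ^ 2 = algebraMap ℚ E (-3)) (y : (V.baseChange E).toAffine.Point) :
    ∃ P₀ : (W.baseChange K).toAffine.Point,
      Affine.Point.map (algebraMap K E).toRatAlgHom P₀ =
        genusTransport W C₁ hC₁ CV hV hθ2 (∑ g ∈ T, ((genusSign θ g : ℤˣ) : ℤ) • pointGalHom V E g y) := by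
  have hθ : θ ≠ -θ := ne_neg_of_ne_zero (theta_ne_zero hθ2)
  refine exists_point_map_eq_genusTransport W C₁ hC₁ CV hV hθ2 _ (fun τ hτ => ?_) (fun τ hτ => ?_)
  · have h1 := pointGalHom_chiSum V G T hT hθ2 (hG τ) y
    rw [pointGalHom_restrictScalars V τ, show genusSign θ (τ.restrictScalars ℚ : E ≃ₐ[ℚ] E) = 1 from
      (genusSign_eq_one_iff θ _).mpr hτ, Units.val_one, one_smul] at h1
    -- `convert`: the point group structures on the two sides are built from different (propositionally equal)
    -- `DecidableEq E` instances (part 10 is stated classically)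
    convert h1
  · have h1 := pointGalHom_chiSum V G T hT hθ2 (hG τ) y
    rw [pointGalHom_restrictScalars V τ, show genusSign θ (τ.restrictScalars ℚ : E ≃ₐ[ℚ] E) = -1 from
      (genusSign_eq_neg_one_iff hθ2 hθ _).mpr hτ, Units.val_neg, Units.val_one, neg_smul, one_smul] at h1
    convert h1

end Descent

/-! ## §3 `L′(V^{(−3)}/K) = L′(W/K)` -/

section LFunction

variable (K : Type) [Field K] [NumberField K]

/-- `LDerivEK` is an isomorphism invariant: `L′((C • X)/K) = L′(X/K)` (`entireLFunction_smul`; `(C • X)^{(d)} = C′ • X^{(d)}`,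
`quadraticTwist_smul`). [cite: SilvermanAEC2009, App. C §16] -/
theorem LDerivEK_smul (X : WeierstrassCurve ℚ) [X.IsElliptic] (C : VariableChange ℚ) : LDerivEK (C • X) K = LDerivEK X K := by
  have hd : (NumberField.discr K : ℚ) ≠ 0 := by exact_mod_cast NumberField.discr_ne_zero K
  haveI := X.isElliptic_quadraticTwist hd
  unfold LDerivEK
  rw [WeierstrassCurve.quadraticTwist_smul, entireLFunction_smul, entireLFunction_smul]

/-- **`L′(V^{(−3)}/K, 1) = L′(W/K, 1)` for the twist partner `V = CV • W^{(−3)}`**: `V^{(−3)} = C′ • W^{(9)} = C″ • W^{(1)} = C‴ • W`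
(`quadraticTwist_smul`, `quadraticTwist_quadraticTwist`, `exists_variableChange_quadraticTwist_mul_sq`,
`exists_variableChange_quadraticTwist_one`) and `LDerivEK_smul`. This identifies the fact's `LDerivEK (V.quadraticTwist (-3)) K`
(`= L′(V/K, χ₋₃∘Nm, 1)` by Artin formalism) with the stub's `LDerivEK W K`. [cite: SilvermanAEC2009, X.5 Cor. 5.4, App. C §16] -/
theorem LDerivEK_quadraticTwist_negThree_of_smul_eq (W : WeierstrassCurve ℚ) [W.IsElliptic] {V : WeierstrassCurve ℚ}
    (CV : VariableChange ℚ) (hV : CV • W.quadraticTwist (-3) = V) : LDerivEK (V.quadraticTwist (-3)) K = LDerivEK W K := by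
  obtain ⟨C₁, hC₁⟩ := exists_variableChange_quadraticTwist_one W
  obtain ⟨C₃, hC₃⟩ := exists_variableChange_quadraticTwist_mul_sq W 1 3 (by norm_num)
  haveI h1 : (W.quadraticTwist 1).IsElliptic := W.isElliptic_quadraticTwist one_ne_zero
  haveI h9 : (W.quadraticTwist ((-3 : ℚ) * -3)).IsElliptic := W.isElliptic_quadraticTwist (by norm_num)
  have e9 : W.quadraticTwist ((-3 : ℚ) * -3) = (C₃ * C₁) • W := by
    rw [mul_smul, hC₁, hC₃]; norm_num
  haveI : ((W.quadraticTwist (-3)).quadraticTwist (-3)).IsElliptic := by rw [quadraticTwist_quadraticTwist]; exact h9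
  rw [← hV, WeierstrassCurve.quadraticTwist_smul, LDerivEK_smul, quadraticTwist_quadraticTwist, e9, LDerivEK_smul]

end LFunction

/-! ## §4 The REAL display of (DISPLAY-L) from (B1χ) -/

section Display

open NumberField Literature.NumberTheory.EllipticCurves.ModularForms CongruenceSubgroup
  Literature.NumberTheory.QuadraticFields.Quadratic Literature.NumberTheory.EllipticCurves.Rank1Residual
  Summit.BirchSwinnertonDyer.Rank1Residual Summit.BirchSwinnertonDyer.Rank1Residual.Additive
  Summit.BirchSwinnertonDyer.Rank1Residual.X11b Summit.BirchSwinnertonDyer.Rank1Residual.X11b.Three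

variable {K : Type} [Field K] [NumberField K]

/-- `Gal(K[n]/K)` contains the `ℚ`-restriction of every `K`-automorphism of `K[n]` (`ringClassGal` is the fixing subgroup of `ι(K)`,
and `(algebraMap K K[n] k : ℂ) = ι k`). [folklore] -/
theorem restrictScalars_mem_ringClassGal (ι : K →+* ℂ) (n : ℕ) (τ : ringClassField K ι n ≃ₐ[K] ringClassField K ι n) :
    (τ.restrictScalars ℚ : ringClassField K ι n ≃ₐ[ℚ] ringClassField K ι n) ∈ ringClassGal ι n := by
  rw [ringClassGal, mem_fixingSubgroup_iff]
  rintro x ⟨k, hk⟩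
  have hx : x = algebraMap K (ringClassField K ι n) k := Subtype.ext (by rw [coe_algebraMap_ringClassField]; exact hk.symm)
  rw [hx]
  exact τ.commutes k

/-- **The REAL DISPLAY of (DISPLAY-L) at the bottom of the genus descent.** Data: the leaf curve `W` (`Addv W 3`, `SubGss W 3`) with a
parametrisation datum `Dt`; a completed-square model `W₁ = C₁ • W` and the `3`-good partner `V = CV • W₁^{(−3)}` (globally minimal,
`V[3]` irreducible) ISOGENOUS to a curve `V₀` carrying a datum `D₀` (on the line: the optimal curve of `V`'s class — the isogeny is
Faltings' theorem for the stub's free `V₀`); a datum `DtV` of `V` at `D₀`'s level with the same newform; `K` imaginary quadratic with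
`d_K` odd and `3` split; `ι`, `θ ∈ K[3]` with `θ² = −3`, an enumeration `T` of `Gal(K[3]/K)`, a point `y₃ ∈ V(K[3])`, `degy ≥ 1`, and
the (B1χ) clause of `shimuraCurve_heegnerSystem_genusThree` AT these data. CONCLUSION: a point `P ∈ W(K)`, `degS ≥ 1` with
`ord₃ degS = ord₃ degy`, the stub's real display `degS·L′(W/K,1) = (2covol(Λ_W)·deg(D₀)/(c(D₀)²(w_K/2)²√|d_K|))·ĥ_K(P)`, and the
bookkeeping `P↑K[3] = c • ψ_θ(P_χ)` for an integer `c` prime to `3` (`P_χ = Σ_{g ∈ T} χ(g)·g y₃`). PROOF: §2 descent `P₁`, part 10 §4–§5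
heights `ĥ_{K[3]}(P_χ) = [K[3]:K]·ĥ_K(P₁)`, §3 `L′(V^{(−3)}/K) = L′(W/K)`, part 9 class ledger `c²·(display constant) = n·(8π²(f₀,f₀)/3)`,
`ĥ(cP₁) = c²ĥ(P₁)`, `w_K = 2`; `degS := n·degy`, `P := c • P₁`. CONDITIONAL on its displayed hypotheses only; BSD is not proved.
[cite: CaiShuTian2014, Thm. 1.5 and special case 1 (u = 1, c = 3)] [cite: ZagierCMB1985, §1 (p. 374)]
[cite: SilvermanAEC2009, VIII.9.1, VIII.9.3 (b), X.5 Cor. 5.4] -/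
theorem realDisplay_of_genusThree_bottom
    (W : WeierstrassCurve ℚ) [W.IsElliptic] [W.IsGloballyMinimal] (hadd : Addv W 3) (hsub : SubGss W 3)
    {N : ℕ} [NeZero N] (Dt : ModularParametrizationData W N)
    {W₁ : WeierstrassCurve ℚ} [W₁.IsCharNeTwoNF] (C₁ : VariableChange ℚ) (hC₁ : C₁ • W = W₁)
    {V : WeierstrassCurve ℚ} [V.IsElliptic] [V.IsGloballyMinimal] (CV : VariableChange ℚ) (hV : CV • W₁.quadraticTwist (-3) = V)
    (hirrV : V.HasIrreducibleModPGaloisRep 3)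
    {NV : ℕ} [NeZero NV] {V₀ : WeierstrassCurve ℚ} [V₀.IsElliptic] [V₀.IsGloballyMinimal] (D₀ : ModularParametrizationData V₀ NV)
    (hiso : V.IsIsogenous V₀) (DtV : ModularParametrizationData V NV) (hf : DtV.f = D₀.f)
    (hK : IsImaginaryQuadratic K) (hodd : Odd (NumberField.discr K))
    (hps : ((Ideal.span {((3 : ℕ) : ℤ)}).primesOver (𝓞 K)).ncard = 2)
    (ι : K →+* ℂ) [NumberField (ringClassField K ι 3)]
    {θ : ringClassField K ι 3} (hθ2 : θ ^ 2 = algebraMap ℚ (ringClassField K ι 3) (-3))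
    (T : Finset (ringClassField K ι 3 ≃ₐ[ℚ] ringClassField K ι 3)) (hT : ∀ g, g ∈ T ↔ g ∈ ringClassGal ι 3)
    (y₃ : (V.baseChange (ringClassField K ι 3)).toAffine.Point) {degy : ℕ} (hdegy : 0 < degy)
    (hB1 : (degy : ℂ) * (Module.finrank K (ringClassField K ι 3) : ℂ) * LDerivEK (V.quadraticTwist (-3)) K =
          8 * (Real.pi : ℂ) ^ 2 * peterssonProduct (Gamma0 NV) 2 DtV.f DtV.f /
              ((3 * √|(NumberField.discr K : ℝ)| : ℝ) : ℂ) *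
            ((∑ g ∈ T, ((genusSign θ g : ℤˣ) : ℤ) •
                pointGalHom V (ringClassField K ι 3) g y₃).canonicalHeight : ℂ)) :
    ∃ (P : (W.baseChange K).toAffine.Point) (degS : ℕ) (c : ℤ), 0 < degS ∧ ¬ (3 : ℤ) ∣ c ∧
      padicValNat 3 degS = padicValNat 3 degy ∧
      (degS : ℂ) * LDerivEK W K =
        ((2 * ZLattice.covolume Dt.L.lattice * (D₀.modularDegree : ℝ) /
            ((D₀.c : ℝ) ^ 2 * ((Units.torsionOrder K : ℝ) / 2) ^ 2 * √|(NumberField.discr K : ℝ)|) *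
          P.canonicalHeight : ℝ) : ℂ) ∧
      Affine.Point.map (algebraMap K (ringClassField K ι 3)).toRatAlgHom P =
        c • genusTransport W C₁ hC₁ CV hV hθ2
          (∑ g ∈ T, ((genusSign θ g : ℤˣ) : ℤ) • pointGalHom V (ringClassField K ι 3) g y₃) := by
  haveI h3F : Fact (Nat.Prime 3) := ⟨Nat.prime_three⟩
  have hp : (3 : ℕ).Prime := Nat.prime_three
  -- the extension `K[3]/K` is finite Galois
  haveI hGal : IsGalois K (ringClassField K ι 3) := (finiteDimensional_and_isGalois_ringClassField hK ι (by norm_num)).2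
  haveI hfd : FiniteDimensional K (ringClassField K ι 3) := (finiteDimensional_and_isGalois_ringClassField hK ι (by norm_num)).1
  haveI : (W.baseChange K).IsElliptic := by rw [WeierstrassCurve.baseChange]; infer_instance
  set Pχ : (V.baseChange (ringClassField K ι 3)).toAffine.Point :=
    ∑ g ∈ T, ((genusSign θ g : ℤˣ) : ℤ) • pointGalHom V (ringClassField K ι 3) g y₃ with hPχ
  -- §2: descent of `ψ_θ(P_χ)` to `W(K)`
  obtain ⟨P₁, hP₁⟩ := exists_point_map_eq_genusTransport_chiSum W C₁ hC₁ CV hV (K := K) (ringClassGal ι 3)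
    (restrictScalars_mem_ringClassGal ι 3) T hT hθ2 y₃
  -- heights: `[K:ℚ]·ĥ_{K[3]}(P_χ) = [K[3]:ℚ]·ĥ_K(P₁)`, i.e. `ĥ_{K[3]}(P_χ) = [K[3]:K]·ĥ_K(P₁)`
  have hh := finrank_mul_canonicalHeight_eq_of_map_eq_genusTransport W C₁ hC₁ CV hV hθ2 Pχ P₁ hP₁
  have hK2 : Module.finrank ℚ K = 2 := hK.1
  have htower : (Module.finrank ℚ (ringClassField K ι 3) : ℝ) = 2 * Module.finrank K (ringClassField K ι 3) := by
    rw [← Module.finrank_mul_finrank ℚ K (ringClassField K ι 3), hK2]; push_cast; ring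
  have hdeg0 : (0 : ℝ) < Module.finrank K (ringClassField K ι 3) := by exact_mod_cast Module.finrank_pos
  have hheight : Pχ.canonicalHeight = Module.finrank K (ringClassField K ι 3) * P₁.canonicalHeight := by
    rw [hK2, htower] at hh
    push_cast at hh
    linarith
  -- §3: `L′(V^{(−3)}/K) = L′(W₁/K) = L′(W/K)`
  haveI : W₁.IsElliptic := by rw [← hC₁]; infer_instance
  have hL : LDerivEK (V.quadraticTwist (-3)) K = LDerivEK W K := by
    rw [LDerivEK_quadraticTwist_negThree_of_smul_eq K W₁ CV hV, ← hC₁, LDerivEK_smul]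
  -- the Petersson norm is real; the newform of `V` is that of `V₀`
  have hPet : peterssonProduct (Gamma0 NV) 2 DtV.f DtV.f = ((peterssonProduct (Gamma0 NV) 2 D₀.f D₀.f).re : ℂ) := by
    rw [hf]; exact peterssonProduct_self_eq_ofReal (Gamma0 NV) 2 D₀.f
  -- part 9: the class ledger `c²·(2covol(Λ_W)deg(D₀)/c(D₀)²) = n·(8π²(f₀,f₀)/3)`, `3 ∤ c`, `3 ∤ n` (`V = (CV·C₁′) • W^{(−3)}`)
  have hV' : (CV * (⟨C₁.u, (-3) * C₁.r, 0, 0⟩ : VariableChange ℚ)) • W.quadraticTwist (-3) = V := by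
    rw [mul_smul, ← WeierstrassCurve.quadraticTwist_smul, hC₁, hV]
  obtain ⟨c, n, hc0, hn0, hc3, hn3, hledger⟩ :=
    LeafPartnerClassLedger.displayConstant_eq_cstConstant_mul_unit_of_isIsogenous W hadd hsub Dt _ hV' hirrV D₀ hiso
  -- `w_K = 2` (`d_K` odd and `3` split force `d_K < −4`)
  have hw : (Units.torsionOrder K : ℝ) / 2 = 1 := by
    haveI : IsTotallyComplex K := hK.2
    have hneg : NumberField.discr K < 0 := discr_neg_of_finrank_eq_two K hK.1
    have hd4 : NumberField.discr K % 4 = 1 := discr_emod_four_eq_one hK.1 hodd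
    have hps' : SplitsIn K 3 := hps
    have hpd : ¬ ((3 : ℕ) : ℤ) ∣ NumberField.discr K := not_dvd_discr_of_splitsIn hK.1 hp hps'
    have h3d : NumberField.discr K ≠ -3 := by intro h; apply hpd; rw [h]; norm_num
    have h4 : NumberField.discr K < -4 := by omega
    rw [Literature.NumberTheory.DiophantineGeometry.torsionOrder_eq_two_of_discr_lt hK.1 h4]; norm_num
  -- from (B1χ): `degy · L′(W/K,1) = (8π²(f₀,f₀)/(3√|d_K|)) · ĥ_K(P₁)`
  have hD0 : (Module.finrank K (ringClassField K ι 3) : ℂ) ≠ 0 := by exact_mod_cast hdeg0.ne'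
  have key : (degy : ℂ) * LDerivEK W K =
      (((8 * Real.pi ^ 2 * (peterssonProduct (Gamma0 NV) 2 D₀.f D₀.f).re / (3 * √|(NumberField.discr K : ℝ)|)) *
        P₁.canonicalHeight : ℝ) : ℂ) := by
    rw [hL, hPet, hheight] at hB1
    apply mul_left_cancel₀ hD0
    push_cast at hB1 ⊢
    linear_combination hB1
  have hsqrt : (0 : ℝ) < √|(NumberField.discr K : ℝ)| :=
    Real.sqrt_pos.mpr (abs_pos.mpr (by exact_mod_cast NumberField.discr_ne_zero K))
  have hcM : (D₀.c : ℝ) ≠ 0 := by exact_mod_cast D₀.maninConstant_ne_zero_holds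
  -- the real identity behind the display: `n·(8π²(f₀,f₀)/(3√d))·ĥ = (2covol·deg/(c₀²√d))·c²ĥ` by the ledger
  have keyR : (n : ℝ) * ((8 * Real.pi ^ 2 * (peterssonProduct (Gamma0 NV) 2 D₀.f D₀.f).re /
        (3 * √|(NumberField.discr K : ℝ)|)) * P₁.canonicalHeight) =
      2 * ZLattice.covolume Dt.L.lattice * (D₀.modularDegree : ℝ) /
          ((D₀.c : ℝ) ^ 2 * (1 : ℝ) ^ 2 * √|(NumberField.discr K : ℝ)|) * ((c : ℝ) ^ 2 * P₁.canonicalHeight) := by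
    have e1 : 2 * ZLattice.covolume Dt.L.lattice * (D₀.modularDegree : ℝ) /
          ((D₀.c : ℝ) ^ 2 * (1 : ℝ) ^ 2 * √|(NumberField.discr K : ℝ)|) * ((c : ℝ) ^ 2 * P₁.canonicalHeight) =
        ((c : ℝ) ^ 2 * (2 * ZLattice.covolume Dt.L.lattice * (D₀.modularDegree : ℝ) / ((D₀.c : ℝ) ^ 2))) *
          (P₁.canonicalHeight / √|(NumberField.discr K : ℝ)|) := by
      field_simp
    rw [e1, hledger]
    field_simp
  refine ⟨c • P₁, n * degy, c, Nat.mul_pos (Nat.pos_of_ne_zero hn0) hdegy, hc3, ?_, ?_, ?_⟩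
  · rw [padicValNat.mul hn0 hdegy.ne', padicValNat.eq_zero_of_not_dvd hn3, zero_add]
  · rw [WeierstrassCurve.Affine.Point.canonicalHeight_zsmul_holds (W := W.baseChange K) c P₁, hw, ← keyR]
    push_cast
    rw [mul_assoc, key]
    push_cast
    ring
  · rw [map_zsmul, hP₁]

end Display

end Summit.BirchSwinnertonDyer.BirchSwinnertonDyer.Theorems.LeafPartnerGenusBottom

end
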